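import Summits.QuantumAdvantage.QuantumAdvantage.Theorems.CubicForrelationNearExactIsExactCubicFormRadical
import Summits.QuantumAdvantage.QuantumAdvantage.Theorems.CubicForrelationNearExactIsExactCubicForm
import Summits.QuantumAdvantage.QuantumAdvantage.Theorems.CubicForrelationNearExactIsExactTwelveOddWeightLight

/-!
# Crux `CubicForrelation.NearExactIsExact` (stmt-QuantumAdvantage-14043) — SYMPLECTIC COORDINATES: a maximal frame as parity forms with a
  dual family, and the expansion `B(v,w) = Σᵢ (B(v,cᵢ)B(w,bᵢ) + B(v,bᵢ)B(w,cᵢ))`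

Certificate seat `b2b-cforr-cert` (gen 41).  HONEST FRAMING: kernel-checked bookkeeping (standard axioms) preparing the input of
…CubicFormFrameK (`tcg_adapted_frame_le`: frames from parity forms with a dual family) from the output of …CubicFormSymplectic /
…CubicFormSymplecticKer (maximal symplectic frames), so that a light cell's cubic form `t̄ = z ∧ B` (…CubicFormHyperplane) can be written
`s₀ ∧ ω_{2h}` in coordinates (Lean roadmap for `E1280-even`, HOME/b2b-cforr-cert-g40/LEAN-PLAN-E1280-EVEN.md §4).  Nothing about `θ₁₂`;
NOT summit progress.

* `tsc_additive_parity`: an additive `f : 𝔽₂ⁿ → Bool` is the parity form `x ↦ ⟨x, ζ⟩` with `ζⱼ = f(eⱼ)`; so `B(·, cᵢ)`, `B(·, bᵢ)` are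
  parity forms.
* `tsc_correct`: given `⟨v₀,z⟩ = 1` and a frame inside `ker z`, some `v₀'` has `⟨v₀',z⟩ = 1` and is `B`-orthogonal to the frame
  (`v₀' = v₀ ⊕ Σ B(v₀,cᵢ)bᵢ ⊕ B(v₀,bᵢ)cᵢ`, by induction) — the dual vector of the form `z`.
* `tsc_form_expansion` (**main**): for a MAXIMAL frame, `[B(v,w)] = Σᵢ [B(v,cᵢ)][B(w,bᵢ)] + [B(v,bᵢ)][B(w,cᵢ)]` in `𝔽₂` — i.e.
  `B = Σᵢ pᵢ ∧ qᵢ` with `pᵢ = B(·,cᵢ)`, `qᵢ = B(·,bᵢ)`; descent to the radical (…CubicFormRadical `tce_radical_of_orth`).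

References: L. E. Dickson (1901); F. J. MacWilliams, N. J. A. Sloane (1977) Ch. 15 §2 Thm 4.  Axioms: the standard three.
-/

set_option linter.dupNamespace false -- D-0017: single-problem summit ⇒ `QuantumAdvantage.QuantumAdvantage` by design

namespace Summit.QuantumAdvantage.QuantumAdvantage.Theorems.CubicForrelation.NearExactIsExact

open Finset
open Literature.Computability.QuantumComplexity.BuzetChailloux (bxor zeroVec bxor_comm bxor_self bxor_zeroVec zeroVec_bxor
  bxor_bxor_cancel_left)

variable {n : ℕ}

/-- **An additive Boolean functional is a parity form**: `f(x) = ⟨x, ζ⟩` with `ζⱼ = f(eⱼ)`. [folklore] -/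
theorem tsc_additive_parity (f : (Fin n → Bool) → Bool) (hadd : ∀ u u', f (bxor u u') = (f u ^^ f u')) (x : Fin n → Bool) :
    f x = decide (Odd #(univ.filter fun j => x j && (fun l => f (fun l' => decide (l' = l))) j)) := by
  classical
  have h0 : f zeroVec = false := by
    have e := hadd zeroVec zeroVec
    rw [bxor_self] at e
    revert e; cases f zeroVec <;> decide
  have e := tcf_linear_sum f h0 hadd (fun i => if x i = true then (1 : ZMod 2) else 0)
  have hx : (fun i => decide ((if x i = true then (1 : ZMod 2) else 0) = 1)) = x := by
    funext i; cases x i <;> decide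
  rw [hx] at e
  have hs : (∑ i, (if x i = true then (1 : ZMod 2) else 0) * (if f (fun l => decide (l = i)) = true then (1 : ZMod 2) else 0)) =
      ((#(univ.filter fun j => x j && f (fun l' => decide (l' = j))) : ℕ) : ZMod 2) := by
    rw [Finset.natCast_card_filter]
    refine sum_congr rfl fun j _ => ?_
    cases x j <;> cases f (fun l' => decide (l' = j)) <;> simp
  rw [hs] at e
  have key : ∀ (a : Bool) (t : ZMod 2), (if a = true then (1 : ZMod 2) else 0) = t → a = decide (t = 1) := by decide
  rw [key _ _ e]
  exact decide_eq_decide.mpr (ZMod.natCast_eq_one_iff_odd)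

section Frame

variable (B : (Fin n → Bool) → (Fin n → Bool) → Bool) (hsymm : ∀ x y, B x y = B y x)
  (hadd : ∀ x y z, B (bxor x y) z = (B x z ^^ B y z))
  (h : ℕ) (b c : Fin h → (Fin n → Bool))
  (hbc : ∀ i, B (b i) (c i) = true) (hbc' : ∀ i j, i ≠ j → B (b i) (c j) = false)
  (hbb : ∀ i j, B (b i) (b j) = false) (hcc : ∀ i j, B (c i) (c j) = false)
include hsymm hadd hbc hbc' hbb hcc

/-- **The dual vector of `z`.**  If `⟨v₀, z⟩ = 1` and the frame lies in `ker z`, then some `v₀'` with `⟨v₀', z⟩ = 1` is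
`B`-orthogonal to every frame vector. [folklore] -/
theorem tsc_correct (z v₀ : Fin n → Bool) (hv₀ : decide (Odd #(univ.filter fun j => v₀ j && z j)) = true)
    (hbz : ∀ i, decide (Odd #(univ.filter fun j => b i j && z j)) = false)
    (hcz : ∀ i, decide (Odd #(univ.filter fun j => c i j && z j)) = false) :
    ∃ v : Fin n → Bool, decide (Odd #(univ.filter fun j => v j && z j)) = true ∧
      (∀ i, B v (b i) = false) ∧ (∀ i, B v (c i) = false) := by
  classical
  -- correct the components one index at a time
  have step : ∀ k, k ≤ h → ∃ v : Fin n → Bool, decide (Odd #(univ.filter fun j => v j && z j)) = true ∧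
      (∀ i : Fin h, i.val < k → B v (b i) = false) ∧ (∀ i : Fin h, i.val < k → B v (c i) = false) := by
    intro k
    induction k with
    | zero => exact fun _ => ⟨v₀, hv₀, fun i hi => absurd hi (Nat.not_lt_zero _), fun i hi => absurd hi (Nat.not_lt_zero _)⟩
    | succ k ih =>
      intro hk
      obtain ⟨v, hvz, hvb, hvc⟩ := ih (Nat.le_of_succ_le hk)
      set i₀ : Fin h := ⟨k, hk⟩ with hi₀
      -- `v' = v ⊕ [B(v,c_{i₀})] b_{i₀} ⊕ [B(v,b_{i₀})] c_{i₀}`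
      set v' : Fin n → Bool := bxor (bxor v (fun j => B v (c i₀) && b i₀ j)) (fun j => B v (b i₀) && c i₀ j) with hv'
      have hsm : ∀ (t : Bool) (y w : Fin n → Bool), B (fun j => t && y j) w = (t && B y w) := by
        intro t y w
        cases t
        · rw [tcf_smul_false, Bool.false_and]
          have e := hadd w w w
          rw [bxor_self] at e
          rw [e]; cases B w w <;> rfl
        · rw [tcf_smul_true, Bool.true_and]
      have hpsm : ∀ (t : Bool) (y : Fin n → Bool), decide (Odd #(univ.filter fun j => (t && y j) && z j)) =
          (t && decide (Odd #(univ.filter fun j => y j && z j))) := by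
        intro t y; cases t
        · simp
        · simp only [Bool.true_and]
      refine ⟨v', ?_, fun i hi => ?_, fun i hi => ?_⟩
      · rw [hv', tow_parity_bxor, tow_parity_bxor, hpsm, hpsm, hvz, hbz, hcz, Bool.and_false, Bool.and_false]; rfl
      · rw [hv', hadd, hadd, hsm, hsm, hbb, hsymm (c i₀) (b i)]
        rcases Nat.lt_succ_iff_lt_or_eq.1 hi with hlt | heq
        · have hne : i ≠ i₀ := fun e => by rw [e, hi₀] at hlt; exact lt_irrefl k hlt
          rw [hvb i hlt, hbc' i i₀ hne]; cases B v (c i₀) <;> cases B v (b i₀) <;> rfl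
        · have hei : i = i₀ := Fin.ext (by rw [hi₀]; exact heq)
          rw [hei, hbc i₀]; cases B v (c i₀) <;> cases B v (b i₀) <;> rfl
      · rw [hv', hadd, hadd, hsm, hsm, hcc]
        rcases Nat.lt_succ_iff_lt_or_eq.1 hi with hlt | heq
        · have hne : i₀ ≠ i := fun e => by rw [← e, hi₀] at hlt; exact lt_irrefl k hlt
          rw [hvc i hlt, hbc' i₀ i hne]; cases B v (c i₀) <;> cases B v (b i₀) <;> rfl
        · have hei : i = i₀ := Fin.ext (by rw [hi₀]; exact heq)
          rw [hei, hbc i₀]; cases B v (c i₀) <;> cases B v (b i₀) <;> rfl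
  obtain ⟨v, hvz, hvb, hvc⟩ := step h le_rfl
  exact ⟨v, hvz, fun i => hvb i i.isLt, fun i => hvc i i.isLt⟩

/-- **Expansion of the form along a maximal frame** (in `𝔽₂`): `[B(v,w)] = Σᵢ [B(v,cᵢ)]·[B(w,bᵢ)] + [B(v,bᵢ)]·[B(w,cᵢ)]`.
Descent: removing the `bⱼ`/`cⱼ`-components of `v` changes both sides alike; a frame-orthogonal `v` is radical
(`tce_radical_of_orth`) and both sides vanish. [cite: MacWilliamsSloane1977, Ch. 15 §2 Thm 4] -/
theorem tsc_form_expansion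
    (hmax : ∀ x y, (∀ i, B x (b i) = false) → (∀ i, B x (c i) = false) → (∀ i, B y (b i) = false) → (∀ i, B y (c i) = false) →
      B x y = false) (v w : Fin n → Bool) :
    (if B v w = true then (1 : ZMod 2) else 0) =
      ∑ i, ((if B v (c i) = true then (1 : ZMod 2) else 0) * (if B w (b i) = true then (1 : ZMod 2) else 0) +
        (if B v (b i) = true then (1 : ZMod 2) else 0) * (if B w (c i) = true then (1 : ZMod 2) else 0)) := by
  classical
  have main : ∀ (m : ℕ) (v : Fin n → Bool),
      #(univ.filter fun i => B v (c i) = true) + #(univ.filter fun i => B v (b i) = true) ≤ m →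
      (if B v w = true then (1 : ZMod 2) else 0) =
        ∑ i, ((if B v (c i) = true then (1 : ZMod 2) else 0) * (if B w (b i) = true then (1 : ZMod 2) else 0) +
          (if B v (b i) = true then (1 : ZMod 2) else 0) * (if B w (c i) = true then (1 : ZMod 2) else 0)) := by
    intro m
    induction m with
    | zero =>
      intro v hm
      have hvc : ∀ i, B v (c i) = false := fun i => by
        by_contra hci; rw [Bool.not_eq_false] at hci
        have : 0 < #(univ.filter fun i => B v (c i) = true) := card_pos.2 ⟨i, mem_filter.2 ⟨mem_univ _, hci⟩⟩
        omega
      have hvb : ∀ i, B v (b i) = false := fun i => by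
        by_contra hbi; rw [Bool.not_eq_false] at hbi
        have : 0 < #(univ.filter fun i => B v (b i) = true) := card_pos.2 ⟨i, mem_filter.2 ⟨mem_univ _, hbi⟩⟩
        omega
      rw [tce_radical_of_orth B hsymm hadd h b c hbc hbc' hbb hmax v hvb hvc w]
      simp only [hvc, hvb]
      simp
    | succ m ih =>
      intro v hm
      by_cases hex : ∃ j, B v (c j) = true
      · obtain ⟨j, hj⟩ := hex
        -- remove the `c_j`-component: `v ↦ v ⊕ b_j`
        have hfc : (univ.filter fun i => B (bxor v (b j)) (c i) = true) = (univ.filter fun i => B v (c i) = true).erase j := by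
          ext i
          simp only [mem_filter, mem_univ, true_and, mem_erase]
          rw [hadd]
          by_cases hij : i = j
          · rw [hij, hj, hbc j]; simp
          · rw [hbc' j i (fun e => hij e.symm), Bool.xor_false]
            exact ⟨fun h1 => ⟨hij, h1⟩, fun h1 => h1.2⟩
        have hfb : (univ.filter fun i => B (bxor v (b j)) (b i) = true) = (univ.filter fun i => B v (b i) = true) := by
          ext i; simp only [mem_filter, mem_univ, true_and]; rw [hadd, hbb j i, Bool.xor_false]
        have hjmem : j ∈ (univ.filter fun i => B v (c i) = true) := mem_filter.2 ⟨mem_univ _, hj⟩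
        have hSpos : 0 < #(univ.filter fun i => B v (c i) = true) := card_pos.2 ⟨j, hjmem⟩
        have hm' : #(univ.filter fun i => B (bxor v (b j)) (c i) = true) + #(univ.filter fun i => B (bxor v (b j)) (b i) = true) ≤ m := by
          rw [hfc, hfb, card_erase_of_mem hjmem]; omega
        have e := ih (bxor v (b j)) hm'
        -- compare both sides before and after
        have hL : B v w = (B (bxor v (b j)) w ^^ B w (b j)) := by
          rw [hadd, hsymm (b j) w]; cases B v w <;> cases B w (b j) <;> rfl
        have hRc : ∀ i, (if B (bxor v (b j)) (c i) = true then (1 : ZMod 2) else 0) =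
            (if B v (c i) = true then (1 : ZMod 2) else 0) + (if j = i then 1 else 0) := by
          intro i
          rw [hadd]
          by_cases hij : i = j
          · rw [hij, hbc j, if_pos rfl]; cases B v (c j) <;> decide
          · rw [hbc' j i (fun e => hij e.symm), Bool.xor_false, if_neg (show ¬ (j = i) from fun e => hij e.symm), add_zero]
        have hRb : ∀ i, (if B (bxor v (b j)) (b i) = true then (1 : ZMod 2) else 0) = (if B v (b i) = true then (1 : ZMod 2) else 0) := by
          intro i; rw [hadd, hbb j i, Bool.xor_false]
        rw [hL, tcf_ite_xor, e]
        simp only [hRc, hRb, add_mul, sum_add_distrib, Finset.sum_boole_mul, mem_univ, if_true]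
        linear_combination CharTwo.add_self_eq_zero (if B w (b j) = true then (1 : ZMod 2) else 0)
      · push Not at hex
        by_cases hex' : ∃ j, B v (b j) = true
        · obtain ⟨j, hj⟩ := hex'
          -- remove the `b_j`-component: `v ↦ v ⊕ c_j`
          have hfb : (univ.filter fun i => B (bxor v (c j)) (b i) = true) = (univ.filter fun i => B v (b i) = true).erase j := by
            ext i
            simp only [mem_filter, mem_univ, true_and, mem_erase]
            rw [hadd, hsymm (c j) (b i)]
            by_cases hij : i = j
            · rw [hij, hj, hbc j]; simp
            · rw [hbc' i j hij, Bool.xor_false]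
              exact ⟨fun h1 => ⟨hij, h1⟩, fun h1 => h1.2⟩
          have hfc : (univ.filter fun i => B (bxor v (c j)) (c i) = true) = (univ.filter fun i => B v (c i) = true) := by
            ext i; simp only [mem_filter, mem_univ, true_and]; rw [hadd, hcc j i, Bool.xor_false]
          have hjmem : j ∈ (univ.filter fun i => B v (b i) = true) := mem_filter.2 ⟨mem_univ _, hj⟩
          have hSpos : 0 < #(univ.filter fun i => B v (b i) = true) := card_pos.2 ⟨j, hjmem⟩
          have hm' : #(univ.filter fun i => B (bxor v (c j)) (c i) = true) +
              #(univ.filter fun i => B (bxor v (c j)) (b i) = true) ≤ m := by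
            rw [hfc, hfb, card_erase_of_mem hjmem]; omega
          have e := ih (bxor v (c j)) hm'
          have hL : B v w = (B (bxor v (c j)) w ^^ B w (c j)) := by
            rw [hadd, hsymm (c j) w]; cases B v w <;> cases B w (c j) <;> rfl
          have hRb : ∀ i, (if B (bxor v (c j)) (b i) = true then (1 : ZMod 2) else 0) =
              (if B v (b i) = true then (1 : ZMod 2) else 0) + (if j = i then 1 else 0) := by
            intro i
            rw [hadd, hsymm (c j) (b i)]
            by_cases hij : i = j
            · rw [hij, hbc j, if_pos rfl]; cases B v (b j) <;> decide
            · rw [hbc' i j hij, Bool.xor_false, if_neg (show ¬ (j = i) from fun e => hij e.symm), add_zero]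
          have hRc : ∀ i, (if B (bxor v (c j)) (c i) = true then (1 : ZMod 2) else 0) = (if B v (c i) = true then (1 : ZMod 2) else 0) := by
            intro i; rw [hadd, hcc j i, Bool.xor_false]
          rw [hL, tcf_ite_xor, e]
          simp only [hRc, hRb, add_mul, sum_add_distrib, Finset.sum_boole_mul, mem_univ, if_true]
          linear_combination CharTwo.add_self_eq_zero (if B w (c j) = true then (1 : ZMod 2) else 0)
        · push Not at hex'
          have hvc : ∀ i, B v (c i) = false := fun i => by simpa using hex i
          have hvb : ∀ i, B v (b i) = false := fun i => by simpa using hex' i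
          rw [tce_radical_of_orth B hsymm hadd h b c hbc hbc' hbb hmax v hvb hvc w]
          simp only [hvc, hvb]
          simp
  exact main _ v le_rfl

end Frame

end Summit.QuantumAdvantage.QuantumAdvantage.Theorems.CubicForrelation.NearExactIsExact
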